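import Literature.NumberTheory.EllipticCurves.Gamma1PeriodLatticeGamma0TwistProofs
import Literature.NumberTheory.EllipticCurves.ManinConstantQuadraticTwistStevensHoldsProofs
import HarnessLib

/-!
# THEOREM 42.19 (2)(ii) — the unit-twist period-lattice chain, kernel-checked skeleton (es g28; T-es-45; typed by typer g19)

The logical chain behind MEMO-es §42.19 (2)(ii) / the turnkey ask T-es-45, written over TREE
declarations only and proved from the TREE's theorems:

* LEMMA⁺ (imc E-imc-15, PROVED: `GaussSumMulMemGamma1OfMemGamma0Twist_holds`):
  `z ∈ Λ(f ⊗ χ; Γ₀(L)) ⇒ g(χ)·z ∈ Λ₁(f; Γ₁(N))`;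
* Stevens 1989 Conjecture I″ at the ROOT, inclusion half: `Λ₁(f) ⊆ ℒ(W)` — for conductor ≤ 200 this is
  Stevens 1989 THEOREM (7.1) (to be filed statement-only by the -ty or -imc seat, T-es-45 (a)); here a HYPOTHESIS
  `h71`;
* Stevens 1989 Lemma (5.2) at an odd prime (PROVED: `stevens1989_neronLattice_quadraticTwist_oddPrime_holds`):
  `z ∈ ℒ(C) ↔ s·z ∈ ℒ(W)` for `C` a minimal model of `W ⊗ χ_{q*}`, `s² = q*`.

Conclusion: every `Γ₀(L)`-period of the twisted form `f ⊗ χ` lies in the Néron lattice of the twisted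
minimal curve — the conclusion shape of E-es-132-U2/U3 (`∀ γ, cuspSymbol g γ ∈ L.lattice`), for ONE odd
prime twist.  What is NOT done here (left to the prover, see MEMO-es 42.19 (4)): (α) the identification
«the newform `g` of `V = [0,0,0,∓q²,0]` / `[0,0,1,0,((q*)³−1)/4]` IS `charTwist (M q²) … f_root`» (Atkin–Li),
which turns the conclusion below into U2/U3 literally; (β) composite `D` (iterate (5.2) over the prime
factors and use `g(χ_D) = ± ∏ g(χ_{q*})`); (γ) filing `h71` as the cite-tagged fact Stevens Thm (7.1).
No proof gaps, no new axioms, nothing asserted: hypotheses in, conclusion out.  BSD is not proved by this.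

TYPER NOTE (typer g19, T-es-45 skeleton).  SOURCE = HOME/es/g28/Derive-U-g28.lean sha16 f9e705fd59de3eb8 (103 l.; es: farm rc 0 · 0 warn; «planner
sketch; NOT a proposal … hand to whoever takes T-es-45»), landed VERBATIM except this note and the namespace `BsdF2ManinEsG28b` →
`Summit.BirchSwinnertonDyer.Rank1Residual.ManinAdditive.KatoCurve.CMOptimal` (sibling of `CMUnitTwistPeriodLattice.lean` = the obligation nodes
E-es-132-U2/U3 `CMPeriodLatticeLawTwoUnitTwists` / `…ThreeUnitTwists` this chain is meant to discharge).  Imports = es's two Literature proof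
files (LEMMA⁺ `GaussSumMulMemGamma1OfMemGamma0Twist_holds`, Stevens (5.2) `stevens1989_neronLattice_quadraticTwist_oddPrime_holds`) —
ROUTE-INDEPENDENT.  WHAT THIS FILE IS: the kernel-checked chain of THEOREM 42.19 (2)(ii) over tree declarations with the Stevens Conjecture-I″
inclusion at the root as an explicit HYPOTHESIS shape `ConjIInclAt f Λ` (a predicate, NOT a conjecture node and NOT a Literature fact); three
PROVED theorems.  WHAT REMAINS for U2/U3 literally (es 42.19 (4), prover work): (α) Atkin–Li identification of the newform of the twisted
minimal model with `charTwist (M q²) … f_root`; (β) composite `D` by iterating (5.2); (γ) the cite-tagged Literature fact «Stevens 1989 Thm (7.1):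
Conjecture I″ holds for conductor ≤ 200» instantiated at `N = 27, 32, 64` — NOT filed by the typer this generation: the held copy of Stevens 1989
(corpus paper:doi-10-1007-bf01388845) has no text layer, so the printed statement could not be quoted verbatim (R2-G44); owed.  Nothing
conjectured here; PARTITION 0 · beyond-print theorem: no · BSD is not proved by this; C2/C3 OPEN.
-/

namespace Summit.BirchSwinnertonDyer.Rank1Residual.ManinAdditive.KatoCurve.CMOptimal

open scoped MatrixGroups ModularForm
open CongruenceSubgroup WeierstrassCurve Literature.NumberTheory.EllipticCurves
  Literature.NumberTheory.EllipticCurves.ModularForms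

/-- Stevens 1989 Conjecture I″ at a root `(f, ℒ)`, INCLUSION half: the `Γ₁(N)`-period lattice of `f` lies
in the lattice `ℒ` (meant: the Néron lattice of the MINIMAL curve of the class of `f`).  For conductor
`≤ 200` this is Stevens 1989 Thm (7.1) (281 classes; AGM + exact `Γ₁` modular symbols). Statement shape
only; the cite-tagged fact is T-es-45 (a). -/
def ConjIInclAt {N : ℕ} (f : CuspForm (Gamma0 N) 2) (Λ : PeriodPair) : Prop :=
  ∀ z ∈ periodLatticeGamma1 f, z ∈ Λ.lattice

/-- **42.19 (2)(ii), abstract form.**  LEMMA⁺ (tree theorem) + Conjecture I″-inclusion at the root +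
the (5.2)-type lattice relation `z ∈ ℒ' ↔ g(χ) z ∈ ℒ` ⇒ every `Γ₀(L)`-cusp-period of `f ⊗ χ` lies in `ℒ'`. -/
theorem cuspSymbol_charTwist_mem_of_conjI
    {N L m : ℕ} [NeZero N] [NeZero L] [NeZero m]
    (hN : N ∣ L) (hm : m ^ 2 ∣ L) (hNm : N * m ∣ L) (hm1 : m ≠ 1)
    (χ : DirichletCharacter ℂ m) (hχ : χ.IsQuadratic) (hprim : χ.IsPrimitive)
    (f : CuspForm (Gamma0 N) 2) (Λ Λ' : PeriodPair)
    (h71 : ConjIInclAt f Λ)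
    (h52 : ∀ z : ℂ, z ∈ Λ'.lattice ↔ gaussSum χ (ZMod.stdAddChar (N := m)) * z ∈ Λ.lattice) :
    ∀ γ : Gamma0 L, cuspSymbol (charTwist L hN hm hχ f) γ ∈ Λ'.lattice := by
  intro γ
  rw [h52]
  exact h71 _ (GaussSumMulMemGamma1OfMemGamma0Twist_holds N L m hN hm hNm hm1 χ hχ hprim f _
    (cuspSymbol_mem_periodLattice _ γ))

/-- **42.19 (2)(ii), one odd prime twist, from the tree's Stevens (5.2).**  `W` = a globally minimal model of
the root curve (meant: the minimal curve `E_*` of its class, e.g. `32a2 = [0,0,0,-1,0]`, `64a4 = [0,0,0,1,0]`,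
`27a3 = [0,0,1,0,0]`) with Néron pair `Λ` and `Γ₁`-inclusion `h71`; `q` an odd prime of good or multiplicative
reduction; `C` any globally minimal model of `W ⊗ χ_{q*}` with Néron pair `Λ'`; `χ` the primitive quadratic
character mod `q` with `g(χ)² = q*` (true for the Legendre character; kept as a hypothesis like the tree's
`not_dvd_maninConstant_of_twist_gamma0_of_stevens`).  Then every `Γ₀(L)`-period of `f ⊗ χ`
(`N ∣ L`, `q² ∣ L`, `N q ∣ L`; for the newform level take `L = N q²`) lies in `Λ'`. -/
theorem cuspSymbol_charTwist_mem_neronLattice_twist_oddPrime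
    (W : WeierstrassCurve ℚ) [W.IsElliptic] [W.IsGloballyMinimal] (Λ : PeriodPair)
    (hΛ : IsNeronLatticeOf (W.baseChange ℂ) Λ)
    (q : ℕ) [Fact q.Prime] [NeZero q] (hq2 : q ≠ 2)
    (hred : W.HasGoodReductionAtPrime q ∨ W.HasMultiplicativeReductionAtPrime q)
    (C : WeierstrassCurve ℚ) [C.IsElliptic] [C.IsGloballyMinimal]
    (hC : ∃ v : VariableChange ℚ, v • W.quadraticTwist (((-1 : ℤ) ^ (q / 2) * q : ℤ) : ℚ) = C)
    (Λ' : PeriodPair) (hΛ' : IsNeronLatticeOf (C.baseChange ℂ) Λ')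
    (χ : DirichletCharacter ℂ q) (hχ : χ.IsQuadratic) (hprim : χ.IsPrimitive)
    (hg : gaussSum χ (ZMod.stdAddChar (N := q)) ^ 2 = (((-1 : ℤ) ^ (q / 2) * q : ℤ) : ℂ))
    {N L : ℕ} [NeZero N] [NeZero L] (hN : N ∣ L) (hm : q ^ 2 ∣ L) (hNm : N * q ∣ L)
    (f : CuspForm (Gamma0 N) 2) (h71 : ConjIInclAt f Λ) :
    ∀ γ : Gamma0 L, cuspSymbol (charTwist L hN hm hχ f) γ ∈ Λ'.lattice := by
  have hq1 : q ≠ 1 := (Fact.out : q.Prime).one_lt.ne'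
  have h52 : ∀ z : ℂ, z ∈ Λ'.lattice ↔ gaussSum χ (ZMod.stdAddChar (N := q)) * z ∈ Λ.lattice :=
    stevens1989_neronLattice_quadraticTwist_oddPrime_holds W Λ hΛ q hq2 hred C hC Λ' hΛ' _ hg
  exact cuspSymbol_charTwist_mem_of_conjI hN hm hNm hq1 χ hχ hprim f Λ Λ' h71 h52

/-- **The optimality half (42.19 (2), last links), abstract lattice form.**  If the twisted minimal lattice
`ℒ'` contains every `Γ₀`-period of `g` (previous theorems) and some `X₀`-datum of a curve of the class has
Néron lattice `Λ₀ = c·Λ(g)` with `ℒ' ⊆ Λ₀` (Stevens Thm (2.3): the minimal lattice lies in every Néron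
lattice of the class) and `c ∈ ℤ`, then `ℒ' ⊆ c·ℒ'`; for a rank-2 lattice this forces `c = ±1`
(index `c²` must be `1`) — that last step is left informal here (it is `Int.natAbs_eq_one_of_…` on the index;
the tree's squeeze `OptimalManinDvdGamma1Manin_holds` is the divisibility version). -/
theorem lattice_sub_smul_of_periods_mem
    {N : ℕ} (g : CuspForm (Gamma0 N) 2) (Λ' Λ₀ : PeriodPair) (c : ℤ)
    (hper : ∀ γ : Gamma0 N, cuspSymbol g γ ∈ Λ'.lattice)
    (hmin : ∀ z ∈ Λ'.lattice, z ∈ Λ₀.lattice)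
    (hopt : ∀ z ∈ Λ₀.lattice, ∃ w ∈ periodLattice g, z = c * w) :
    ∀ z ∈ Λ'.lattice, ∃ w ∈ Λ'.lattice, z = c * w := by
  intro z hz
  obtain ⟨w, hw, rfl⟩ := hopt z (hmin z hz)
  refine ⟨w, ?_, rfl⟩
  -- `w ∈ Λ(g) = closure (range (cuspSymbol g)) ⊆ Λ'`
  have hsub : periodLattice g ≤ Λ'.lattice.toAddSubgroup := by
    unfold periodLattice
    refine (AddSubgroup.closure_le _).mpr ?_
    rintro _ ⟨γ, rfl⟩
    exact hper γ
  exact hsub hw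

end Summit.BirchSwinnertonDyer.Rank1Residual.ManinAdditive.KatoCurve.CMOptimal
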